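import Literature.NumberTheory.EllipticCurves.KodairaNeronAdditiveProofs
import Literature.NumberTheory.EllipticCurves.KodairaNeronUnramifiedInertiaProofs
import Literature.NumberTheory.EllipticCurves.GeomPointsGaloisModule
import Literature.NumberTheory.EllipticCurves.IsogenyGeomEndRingOrdinaryCommProofs
import Literature.NumberTheory.EllipticCurves.KummerMap
import Literature.NumberTheory.EllipticCurves.PrimaryTorsionGaloisRep
import Literature.NumberTheory.EllipticCurves.BigGaloisRepSelmer
import HarnessLib

/-!
# `E[p^∞]^{I_w}` is finite at a place `w ∤ p` of ADDITIVE reduction (theorems only)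

Topic `NumberTheory/EllipticCurves`. THEOREMS ONLY (no definition, no named fact, no `sorry`).
Cell `bsd-stepL`, K2 support 20495 (`JSWSigmaLocalCharIdeal`), module L5, input (A1) of
`JetchevSkinnerWan2017.sigmaLocal_of_ne_zero_of_finite_inertia` (the additive finitely decomposed
places of the local `Σ`-atom).

The tree proves Silverman *ATAEC* Thm. IV.10.2(a), additive case — `(V_ℓ E)^{I_𝔓} = 0` — in the
rational-Tate-module currency (`codimFixed_inertia_rationalTate_eq_two_of_hasAdditiveReductionAt_holds`,
`InertiaInvariantsAdditiveProofs`). The consumers of the local `Σ`-atom need the same mathematics in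
the currency of the discrete module `E[p^∞] = PrimaryTorsion (geomPoints E) p` and of the LOCAL inertia
group `absInertia K_w ≤ Γ_{K_w}` mapped to `Γ_K` by `localMap K (inl w) = absGaloisRestrict K K_w`.
This file proves it directly from the same two inputs as the tree's proof (Serre–Tate, *Good
reduction of abelian varieties*, §1 Lemma 2; Silverman *ATAEC* p. 359):

* `WeierstrassCurve.exists_nsmul_eq_zero_of_absInertia_fixed_of_hasAdditiveReductionAt` — **there is
  `c ≠ 0` killing every `I_w`-fixed `ℓ`-power torsion point of `E(K̄)`**: Kodaira–Néron as an exponent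
  (`exists_nsmul_hasNonsingularReduction_of_kodairaNeron`, fed with the tree's theorem
  `kodairaNeron_exists_finset_reducesToNonsingular_of_hasAdditiveReductionAt`) puts `c • P` in `E₀` of a
  `w`-integral minimal model; its reduction lies in `Ẽ_ns(k̄) = k̄⁺`
  (`exists_addMonoidHom_residueField_of_cusp`), which has no `ℓ`-torsion (`(ℓ : k̄) ≠ 0`), so `c • P`
  reduces to `O`; an `ℓ`-power torsion point reducing to `O` is `O` (`ReducesToZero.eq_zero_of_zsmul_eq_zero`,
  *AEC* VII.3.1). The passage local inertia ↔ `𝔐.inertia Γ_{K_v}` is `inertia_eq_absInertia`, and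
  `E(K̄) → E(K̄_v)` is the equivariant injection `pointsMapOfEmb` for the tree's chosen embedding.
* `WeierstrassCurve.finite_setOf_primaryTorsionGaloisRep_localMap_fixed_of_hasAdditiveReductionAt` —
  **`{a ∈ E[p^∞] | I_w fixes a}` is finite** (it injects into `E[c]`, finite by
  `finite_geomTorsion_natCast`), literally the hypothesis `hfinI` of
  `sigmaLocal_of_ne_zero_of_finite_inertia`.

## References

* [SilvermanATAEC1994] J. H. Silverman, *Advanced Topics in the Arithmetic of Elliptic Curves* (1994),
  Thm. IV.10.2(a), additive case, and its proof (PDF pp. 358–359); Cor. IV.9.2(d).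
* [SerreTate1968] J.-P. Serre, J. Tate, *Good reduction of abelian varieties*, Ann. of Math. 88 (1968),
  §1 Lemmas 1–2.
* [SilvermanAEC2009] J. H. Silverman, *The Arithmetic of Elliptic Curves* (2009), VII.2.1, VII.3.1, VII.6.2.
* [GreenbergVatsal2000] R. Greenberg, V. Vatsal, Invent. Math. 142 (2000), §2 Prop. 2.4 (the case
  `E[p^∞]^{I_ℓ}` finite).
-/

noncomputable section

open scoped Classical NNReal Pointwise
open NumberField IsDedekindDomain

universe u

namespace WeierstrassCurve

open Literature.NumberTheory.EllipticCurves Literature.NumberTheory.GaloisRepresentations Field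
  IsDedekindDomain.HeightOneSpectrum Literature.NumberTheory.EllipticCurves.BigGaloisRep

variable {K : Type u} [Field K] [NumberField K] (W : WeierstrassCurve K) {v : HeightOneSpectrum (𝓞 K)}

/-- **A uniform exponent for the `I_w`-fixed `ℓ`-power torsion at an additive place `w ∤ ℓ`.** For an
elliptic curve `E/K` over a number field, a prime `ℓ`, and a finite place `v ∤ ℓ` of additive
reduction, there is `c ≠ 0` with `c • P = O` for every point `P ∈ E(K̄)` of `ℓ`-power order fixed by the
local inertia group `absInertia K_v` (acting through `absGaloisRestrict K K_v`). Serre–Tate §1 Lemma 2 /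
Silverman *ATAEC* p. 359 (`E(K^nr)[ℓ^∞] ↪ E₀ ↠ Ẽ_ns(k̄) = k̄⁺`, no `ℓ`-torsion, kernel `E₁` without
`ℓ`-torsion), with the Kodaira–Néron exponent `c = [E(K^nr)^{fix} : E₀]`.
[cite: SilvermanATAEC1994, Thm. IV.10.2(a), additive case, proof (PDF p. 359), with Cor. IV.9.2(d)]
[cite: SerreTate1968, §1 Lemma 2] [cite: SilvermanAEC2009, Prop. VII.2.1 and VII.3.1] -/
theorem exists_nsmul_eq_zero_of_absInertia_fixed_of_hasAdditiveReductionAt [W.IsElliptic]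
    (ℓ : ℕ) [Fact ℓ.Prime] (hℓ : (ℓ : 𝓞 K) ∉ v.asIdeal) (hadd : W.HasAdditiveReductionAt v) :
    ∃ c : ℕ, c ≠ 0 ∧ ∀ P : geomPoints W,
      (∀ σ ∈ absInertia (v.adicCompletion K), absGaloisRestrict K (v.adicCompletion K) σ • P = P) →
      ∀ n : ℕ, ℓ ^ n • P = 0 → c • P = 0 := by
  obtain ⟨w, hw⟩ := v.exists_spectralValuation
  have hv0 : w.Integers w.integer := Valuation.integer.integers w
  obtain ⟨𝔐, h𝔐⟩ := v.localPrimesAbove_nonempty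
  haveI : (W.localMinimalModel v).IsElliptic := W.isElliptic_localMinimalModel v
  have hKN := W.kodairaNeron_exists_finset_reducesToNonsingular_of_hasAdditiveReductionAt hadd
  -- a `w`-integral model `W₀` of the minimal model
  have hint : ((W.localMinimalModel v).baseChange (AlgebraicClosure (v.adicCompletion K))).IsIntegral
      w.integer := by
    have := isIntegral_spectralValuation_baseChange hw
      ((W.localMinimalModel v).integralModel (v.adicCompletionIntegers K))
    rwa [show ((W.localMinimalModel v).integralModel (v.adicCompletionIntegers K)).map
        (algebraMap (v.adicCompletionIntegers K) (v.adicCompletion K)) = W.localMinimalModel v from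
      baseChange_integralModel_eq (v.adicCompletionIntegers K) (W.localMinimalModel v)] at this
  obtain ⟨W₀, hW₀⟩ := hint.integral
  -- the reduction of `W₀` is a cusp
  have hcoef : ∀ {a : v.adicCompletionIntegers K} (b : w.integer),
      algebraMap w.integer (AlgebraicClosure (v.adicCompletion K)) b =
        algebraMap (v.adicCompletion K) (AlgebraicClosure (v.adicCompletion K))
          (algebraMap (v.adicCompletionIntegers K) (v.adicCompletion K) a) →
      IsDedekindDomain.HeightOneSpectrum.valuation (v.adicCompletion K)
          (IsDiscreteValuationRing.maximalIdeal (v.adicCompletionIntegers K))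
          (algebraMap (v.adicCompletionIntegers K) (v.adicCompletion K) a) < 1 →
      IsLocalRing.residue w.integer b = 0 := by
    intro a b hab hlt
    have hmem : a ∈ IsLocalRing.maximalIdeal (v.adicCompletionIntegers K) :=
      (IsDedekindDomain.HeightOneSpectrum.valuation_lt_one_iff_mem _ a).mp hlt
    rw [← v_algebraMap_lt_one_iff hv0, hab]
    exact spectralValuation_algebraMap_lt_one_of_mem_maximalIdeal hw h𝔐 hmem
  have hΔ : IsLocalRing.residue w.integer W₀.Δ = 0 := by
    refine hcoef (a := ((W.localMinimalModel v).integralModel (v.adicCompletionIntegers K)).Δ)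
      W₀.Δ ?_ ?_
    · rw [integralModel_Δ_eq, ← map_Δ, ← map_Δ]
      change (W₀.baseChange (AlgebraicClosure (v.adicCompletion K))).Δ =
        ((W.localMinimalModel v).baseChange (AlgebraicClosure (v.adicCompletion K))).Δ
      rw [hW₀]
    · rw [integralModel_Δ_eq]; exact hadd.badReduction
  have hc₄ : IsLocalRing.residue w.integer W₀.c₄ = 0 := by
    refine hcoef (a := ((W.localMinimalModel v).integralModel (v.adicCompletionIntegers K)).c₄)
      W₀.c₄ ?_ ?_
    · rw [integralModel_c₄_eq, ← map_c₄, ← map_c₄]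
      change (W₀.baseChange (AlgebraicClosure (v.adicCompletion K))).c₄ =
        ((W.localMinimalModel v).baseChange (AlgebraicClosure (v.adicCompletion K))).c₄
      rw [hW₀]
    · rw [integralModel_c₄_eq]; exact hadd.additiveReduction
  obtain ⟨rc, hrc⟩ := W₀.exists_addMonoidHom_residueField_of_cusp hv0 hΔ hc₄
  -- equivariant transport of `E(K̄_v)` to the minimal model, and the exponent of Kodaira–Néron
  obtain ⟨C, hC⟩ := W.exists_variableChange_smul_eq_localMinimalModel v
  obtain ⟨Φ, hΦ⟩ := W.exists_addEquiv_localPoints_of_smul_eq v hC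
  obtain ⟨c, hc, hcE₀⟩ := exists_nsmul_hasNonsingularReduction_of_kodairaNeron hKN hw h𝔐 hW₀
  -- the injection `F = transport ∘ Φ ∘ ι_*` for the chosen embedding `ι : K̄ → K̄_v`
  set ι : AlgebraicClosure K →ₐ[K] AlgebraicClosure (v.adicCompletion K) :=
    closureEmb (K := K) (v.adicCompletion K) with hι
  let F : geomPoints W →+ (W₀.baseChange (AlgebraicClosure (v.adicCompletion K))).toAffine.Point :=
    (Affine.Point.congrEquiv hW₀).toAddMonoidHom.comp (Φ.toAddMonoidHom.comp (pointsMapOfEmb W ι))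
  have hFapply : ∀ P : geomPoints W,
      F P = Affine.Point.congrEquiv hW₀ (Φ (pointsMapOfEmb W ι P)) := fun _ ↦ rfl
  have hFinj : Function.Injective F := fun P Q hPQ ↦ by
    rw [hFapply, hFapply] at hPQ
    exact pointsMapOfEmb_injective W ι (Φ.injective ((Affine.Point.congrEquiv hW₀).injective hPQ))
  -- `(ℓ : k̄) ≠ 0`
  have hℓw : w ((ℓ : ℤ) : AlgebraicClosure (v.adicCompletion K)) = 1 :=
    spectralValuation_intCast_eq_one hw (n := (ℓ : ℤ)) (by simpa using hℓ)
  have hℓk : ((ℓ : ℕ) : AlgebraicClosure (IsLocalRing.ResidueField w.integer)) ≠ 0 := by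
    have hℓw' : w (algebraMap w.integer (AlgebraicClosure (v.adicCompletion K)) (ℓ : w.integer)) = 1 := by
      rw [map_natCast]; exact_mod_cast hℓw
    have h1 : IsLocalRing.residue w.integer (ℓ : w.integer) ≠ 0 :=
      (v_algebraMap_eq_one_iff hv0 _).mp hℓw'
    have := (_root_.map_ne_zero (algebraMap (IsLocalRing.ResidueField w.integer)
      (AlgebraicClosure (IsLocalRing.ResidueField w.integer)))).mpr h1
    simpa using this
  refine ⟨c, hc, fun P hP n hn ↦ ?_⟩
  -- `ι_* P`, transported, is fixed by the inertia group `I_𝔐 = absInertia K_v`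
  have hfixloc : ∀ σ ∈ 𝔐.inertia (absoluteGaloisGroup (v.adicCompletion K)),
      Affine.Point.map ((absoluteGaloisGroup.toAlgEquiv _ σ :
          AlgebraicClosure (v.adicCompletion K) ≃ₐ[v.adicCompletion K]
            AlgebraicClosure (v.adicCompletion K)) :
          AlgebraicClosure (v.adicCompletion K) →ₐ[v.adicCompletion K]
            AlgebraicClosure (v.adicCompletion K)) (Φ (pointsMapOfEmb W ι P)) =
        Φ (pointsMapOfEmb W ι P) := by
    intro σ hσ
    rw [inertia_eq_absInertia hw h𝔐] at hσ
    rw [← hΦ σ, ← pointsMapOfEmb_smul]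
    congr 2
    -- `res_ι = resGal K_v = absGaloisRestrict K K_v` for the chosen embedding (definitionally)
    have hres : resGalOfEmb ι σ = absGaloisRestrict K (v.adicCompletion K) σ := rfl
    rw [hres]
    exact hP σ hσ
  -- `c • P`, transported, has nonsingular reduction; its image in `k̄⁺` is killed by `ℓ ^ n`, so is `0`
  have hQ : W₀.HasNonsingularReduction (F (c • P)) := by
    rw [hFapply, map_nsmul, map_nsmul]
    exact hcE₀ _ hfixloc
  set Q : W₀.nonsingularReductionSubgroup hv0 := ⟨F (c • P), hQ⟩ with hQdef
  have hℓcP : ℓ ^ n • F (c • P) = 0 := by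
    rw [← map_nsmul, smul_comm, hn, smul_zero, map_zero]
  have hQn : ℓ ^ n • Q = 0 := Subtype.ext (by
    rw [AddSubmonoidClass.coe_nsmul, ZeroMemClass.coe_zero]
    exact hℓcP)
  have hr0 : rc Q = 0 := by
    have h1 : ℓ ^ n • rc Q = 0 := by rw [← map_nsmul, hQn, map_zero]
    rw [nsmul_eq_mul] at h1
    refine (mul_eq_zero.mp h1).resolve_left ?_
    rw [Nat.cast_pow]
    exact pow_ne_zero _ hℓk
  have hred : W₀.ReducesToZero (F (c • P)) := (hrc Q).mp hr0
  -- an `ℓ`-power torsion point reducing to `O` is `O`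
  have hℓnw : w (((ℓ ^ n : ℕ) : ℤ) : AlgebraicClosure (v.adicCompletion K)) = 1 := by
    rw [Nat.cast_pow, Int.cast_pow, map_pow, hℓw, one_pow]
  have hF0 : F (c • P) = 0 :=
    hred.eq_zero_of_zsmul_eq_zero W₀ hℓnw (by rw [natCast_zsmul]; exact hℓcP)
  exact hFinj (by rw [hF0, map_zero])

/-- **`E[p^∞]^{I_w}` is finite at a place `w ∤ p` of additive reduction**, in the currency of the
local `Σ`-atom (`PrimaryTorsion (geomPoints E) p` with `Γ_{K_w}` acting through
`localMap K (inl w) = absGaloisRestrict K K_w`): the fixed points inject into `E[c]` for the exponent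
`c` of `exists_nsmul_eq_zero_of_absInertia_fixed_of_hasAdditiveReductionAt`, and `E[c]` is finite.
This is `(V_pE)^{I_w} = 0` (Silverman *ATAEC* IV.10.2(a), additive case) read on `E[p^∞]`; it is the
hypothesis `hfinI` of `JetchevSkinnerWan2017.sigmaLocal_of_ne_zero_of_finite_inertia`.
[cite: SilvermanATAEC1994, Thm. IV.10.2(a), additive case (PDF pp. 358–359)] [cite: SerreTate1968, §1 Lemma 2]
[cite: GreenbergVatsal2000, §2, proof of Prop. 2.4 (additive primes: `E[p^∞]^{I_ℓ}` finite)] -/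
theorem finite_setOf_primaryTorsionGaloisRep_localMap_fixed_of_hasAdditiveReductionAt [W.IsElliptic]
    (p : ℕ) [Fact p.Prime] (hp : (p : 𝓞 K) ∉ v.asIdeal) (hadd : W.HasAdditiveReductionAt v) :
    Set.Finite {a : PrimaryTorsion (geomPoints W) p |
      ∀ σ ∈ absInertia (v.adicCompletion K),
        (W.primaryTorsionGaloisRep p) (localMap K (Sum.inl v) σ) a = a} := by
  obtain ⟨c, hc, hkill⟩ :=
    W.exists_nsmul_eq_zero_of_absInertia_fixed_of_hasAdditiveReductionAt p hp hadd
  haveI : Finite (geomTorsion W (c : ℤ)) := finite_geomTorsion_natCast W hc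
  let f : {a : PrimaryTorsion (geomPoints W) p |
      ∀ σ ∈ absInertia (v.adicCompletion K),
        (W.primaryTorsionGaloisRep p) (localMap K (Sum.inl v) σ) a = a} → geomTorsion W (c : ℤ) :=
    fun a ↦ ⟨((a : PrimaryTorsion (geomPoints W) p) : geomPoints W), by
      rw [mem_geomTorsion_iff, natCast_zsmul]
      obtain ⟨n, hn⟩ := (a : PrimaryTorsion (geomPoints W) p).exists_pow_smul_eq_zero
      refine hkill _ (fun σ hσ ↦ ?_) n hn
      have h := congrArg (fun b : PrimaryTorsion (geomPoints W) p ↦ (b : geomPoints W)) (a.2 σ hσ)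
      simp only [val_primaryTorsionGaloisRep_apply] at h
      exact h⟩
  have hf : Function.Injective f := fun a b hab ↦ by
    have h1 := Subtype.ext_iff.mp hab
    exact Subtype.ext (PrimaryTorsion.ext h1)
  haveI := Finite.of_injective f hf
  exact Set.toFinite _
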